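import Literature.Probability.Percolation.TriExplorationBoundary
import Literature.Probability.Percolation.TriAnnulusArms
import Literature.Probability.Percolation.InterfaceScalingLimitTriProofs
import Literature.Probability.Percolation.BrickHex
import HarnessLib

/-!
# Multiple shell crossings by the critical site-percolation interface on `δ𝕋`: the AB99 H1 estimate and `isTightLaws_map_triInterface`

Topic: Probability / Percolation. This file proves hypothesis H1 of Aizenman–Burchard (Duke
Math. J. 99 (1999), eq. (1.3); Appendix A: "In two dimensions, our hypotheses H1 and H2 are
satisfied by the independent bond, site, and droplet percolation models … RSW … van den
Berg–Kesten") for the hexagonal exploration path of critical site percolation on the triangular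
lattice in a Jordan Dobrushin domain, in the tree's formulation with a shell-dependent threshold
(`triExploration_traversalBound`, literally the hypothesis `h1` of
`isTightLaws_map_triInterface_of_traversalBound`, `InterfaceScalingLimitTriProofs.lean`), and
with it the tightness statement **crit-perc.S26** (triangular case),
`Literature.Probability.Percolation.isTightLaws_map_triInterface` (AB99 Thm 1.2; Camia–Newman,
PTRF 139 (2007), §5), as `isTightLaws_map_triInterface_holds`.

The argument (AB99, Appendix A: "the `k` crossing segments cut the annulus into sectors, each
containing a monochromatic crossing; BK"), organised as in the bond twin
`InterfaceTraversalBound.lean`, Part III, with the planar input of `TriExplorationPolygon.lean`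
(`IsExplorationPath.sidePair_ne`) and the **new boundary bookkeeping** of
`TriExplorationBoundary.lean`:

1. `tri_traversal_data`: a traversal of `D(x; ρ, R)` (`R ≥ 16Cρ`, `δ ≤ ρ`) contains a tight crossing
   of the middle shell `D(x; Cρ, R/4)` and a middle step whose side segment lies in the annulus
   `𝔸 = B(x, R/2) ∖ B̄(x, 4ρ)`.
2. Many side components (distinct unordered side pairs, `Finset.card_sym2`).
3. **Few tainted components.** A side component is *tainted* if it contains the mesh point of a
   site of the discrete boundary `∂Ω_δ` at a radius of the middle shell. Such a site has an
   exterior representative (`exists_exterior_repr`); two tainted components whose representatives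
   are at distance `< η` coincide, because the exterior of a Jordan curve is uniformly locally
   connected (`JordanDomain.exterior_joinedIn_of_dist_lt`, Newman VI.14·1) and an exterior path
   transports cut vertices along one class of non-`Ω_δ` edges, which miss the polygon
   (`IsExplorationPath.mem_connectedComponentIn_of_exterior_path`). Hence the tainted components
   are at most a packing number `N(ρ)` of `η(ρ)`-separated points of the unit disc — independent
   of the mesh. (This replaces the bond-side count through the boundary parametrisation, which
   needs the polygon to miss the boundary curve; the hexagonal polygon through face centres need
   not.)
4. The remaining components carry pairwise disjoint chains of left (open) or right (closed) sites
   none of which is frozen by the boundary condition, i.e. genuine `ω`-open, resp. `ω`-closed,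
   confined arms of `A(x; Cρ + 2δ, R/4 - 2δ)`: `ω` or `ωᶜ` lies in `triArm □^{j₀}`
   (`tri_arms_of_hasTraversals`), of probability `≤ 2 ((Cρ+3δ)/(R/4-3δ))^{α j₀} ≤ K (ρ/R)^3` by the
   iterated BK inequality, the RSW annulus bound (`TriAnnulusArms.lean`) and the colour-flip
   symmetry of `P_{1/2}`.

Everything is proved; no named fact is introduced.

## References

* M. Aizenman, A. Burchard, *Hölder regularity and dimension bounds for random curves*, Duke
  Math. J. 99 (1999) 419–453, §1.b (1.3), Thm 1.2, Appendix A.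
* F. Camia, C. M. Newman, Probab. Theory Related Fields 139 (2007), §5.
* S. Smirnov, C. R. Acad. Sci. Paris 333 (2001), §2.
* M. H. A. Newman, *Elements of the topology of plane sets of points* (1939), Ch. VI §14.
-/

noncomputable section

open MeasureTheory Metric Set Filter
open _root_.Topology
open scoped unitInterval ENNReal

namespace Literature.Probability.Percolation

open LatticeModels

/-! ### Chains cut at their first exit are confined arms -/

/-- **A chain cut at its first site beyond radius `R` is a confined arm**: if consecutive sites
are equal or adjacent (hence within `δ`), the chain starts in `B̄(x, r)` with `r ≤ R + 2δ` and
some site is at distance `≥ R`, then the site set of the chain lies in `triArm δ x r R`.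
[folklore] -/
theorem mem_triArm_of_chain_cut {δ : ℝ} (hδ : 0 ≤ δ) {x : ℂ} {r R : ℝ} (hrR : r ≤ R + 2 * δ) (N : ℕ)
    (f : ℕ → Site 2) (hstep : ∀ i < N, f i = f (i + 1) ∨ triGraph.Adj (f i) (f (i + 1)))
    (h0 : dist (triMeshPoint δ (f 0)) x ≤ r) (hN : R ≤ dist (triMeshPoint δ (f N)) x) :
    {v | ∃ i ≤ N, v = f i} ∈ triArm δ x r R := by
  classical
  have hex : ∃ k, k ≤ N ∧ R ≤ dist (triMeshPoint δ (f k)) x := ⟨N, le_rfl, hN⟩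
  obtain ⟨hkN, hkR⟩ := Nat.find_spec hex
  set k := Nat.find hex with hk
  have hbefore : ∀ j < k, dist (triMeshPoint δ (f j)) x < R := by
    intro j hj
    by_contra hge
    exact Nat.find_min hex hj ⟨(le_of_lt hj).trans hkN, not_lt.1 hge⟩
  have hconf : ∀ i ≤ k, dist (triMeshPoint δ (f i)) x ≤ R + 2 * δ := by
    intro i hi
    rcases Nat.eq_zero_or_pos i with rfl | hpos
    · exact h0.trans hrR
    · rcases lt_or_eq_of_le hi with hlt | heq
      · linarith [hbefore i hlt]
      · have hprev := hbefore (i - 1) (by omega)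
        have hst := hstep (i - 1) (by omega)
        rw [Nat.sub_add_cancel hpos] at hst
        have hd := dist_triMeshPoint_le_of_eq_or_adj hδ hst
        linarith [dist_triangle (triMeshPoint δ (f i)) (triMeshPoint δ (f (i - 1))) x,
          dist_comm (triMeshPoint δ (f (i - 1))) (triMeshPoint δ (f i))]
  have hsub : {v | ∃ i ≤ k, v = f i} ⊆ {v | ∃ i ≤ N, v = f i} := by
    rintro v ⟨i, hi, rfl⟩; exact ⟨i, hi.trans hkN, rfl⟩
  exact isUpperSet_triArm δ x r R hsub
    ⟨k, f, h0, hkR, fun i hi ↦ hstep i (by omega), fun i hi ↦ ⟨hconf i hi, i, hi, rfl⟩⟩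

/-- **A chain in either orientation, cut appropriately, is a confined arm.** [folklore] -/
theorem mem_triArm_of_chain_cut' {δ : ℝ} (hδ : 0 ≤ δ) {x : ℂ} {r R : ℝ} (hrR : r ≤ R + 2 * δ) (N : ℕ)
    (f : ℕ → Site 2) (hstep : ∀ i < N, f i = f (i + 1) ∨ triGraph.Adj (f i) (f (i + 1)))
    (hends : (dist (triMeshPoint δ (f 0)) x ≤ r ∧ R ≤ dist (triMeshPoint δ (f N)) x) ∨
      (R ≤ dist (triMeshPoint δ (f 0)) x ∧ dist (triMeshPoint δ (f N)) x ≤ r)) :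
    {v | ∃ i ≤ N, v = f i} ∈ triArm δ x r R := by
  rcases hends with ⟨h0, hN⟩ | ⟨h0, hN⟩
  · exact mem_triArm_of_chain_cut hδ hrR N f hstep h0 hN
  · have hset : {v | ∃ i ≤ N, v = f i} = {v | ∃ i ≤ N, v = f (N - i)} := by
      ext v
      constructor
      · rintro ⟨i, hi, rfl⟩; exact ⟨N - i, by omega, by rw [Nat.sub_sub_self hi]⟩
      · rintro ⟨i, hi, rfl⟩; exact ⟨N - i, by omega, rfl⟩
    rw [hset]
    refine mem_triArm_of_chain_cut hδ hrR N (fun i ↦ f (N - i)) (fun i hi ↦ ?_) (by simpa using hN) (by simpa using h0)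
    have h := hstep (N - (i + 1)) (by omega)
    rw [show N - (i + 1) + 1 = N - i by omega] at h
    rcases h with h | h
    · exact Or.inl h.symm
    · exact Or.inr h.symm

/-- **Pairwise disjoint chains (cut at first exit) give iterated disjoint occurrence of the arm
event** for every configuration containing all their sites. [cite: AizenmanBurchardDuke1999, Appendix A] -/
theorem mem_disjointOccurrencePow_triArm_of_chains_cut {δ : ℝ} (hδ : 0 ≤ δ) {x : ℂ} {r R : ℝ} (hrR : r ≤ R + 2 * δ)
    {ω : SiteConfig (Site 2)} {j : ℕ} (N : Fin j → ℕ) (f : Fin j → ℕ → Site 2)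
    (hstep : ∀ i, ∀ p < N i, f i p = f i (p + 1) ∨ triGraph.Adj (f i p) (f i (p + 1)))
    (hmem : ∀ i, ∀ p ≤ N i, f i p ∈ ω)
    (hends : ∀ i, (dist (triMeshPoint δ (f i 0)) x ≤ r ∧ R ≤ dist (triMeshPoint δ (f i (N i))) x) ∨
      (R ≤ dist (triMeshPoint δ (f i 0)) x ∧ dist (triMeshPoint δ (f i (N i))) x ≤ r))
    (hdisj : ∀ i i', i ≠ i' → ∀ p p', p ≤ N i → p' ≤ N i' → f i p ≠ f i' p') :
    ω ∈ disjointOccurrencePow (triArm δ x r R) j := by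
  refine mem_disjointOccurrencePow_of_pairwise_disjoint (isUpperSet_triArm δ x r R)
    (fun i ↦ {v | ∃ p ≤ N i, v = f i p}) (fun i ↦ ?_)
    (fun i ↦ mem_triArm_of_chain_cut' hδ hrR (N i) (f i) (hstep i) (hends i))
    (fun i i' hii ↦ Set.disjoint_left.2 ?_)
  · rintro v ⟨p, hp, rfl⟩; exact hmem i p hp
  · rintro v ⟨p, hp, rfl⟩ ⟨p', hp', h⟩
    exact hdisj i i' hii p p' hp hp' h

/-! ### Packing of separated points in a disc -/

/-- **Packing bound**: a finite set of points of `B̄(x, 1)` pairwise at distance `≥ η` has at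
most `⌊81 (min η 1 / 3)⁻²⌋₊` elements (cover the disc by balls of radius `min η 1 / 3`,
`exists_finset_card_le_cover_closedBall`; each contains at most one of the points). [folklore] -/
theorem card_le_of_separated {x : ℂ} {η : ℝ} (hη : 0 < η) (T : Finset ℂ) (hT : ∀ z ∈ T, z ∈ closedBall x 1)
    (hsep : ∀ z ∈ T, ∀ z' ∈ T, z ≠ z' → η ≤ dist z z') :
    T.card ≤ ⌊81 * (min η 1 / 3) ^ (-(2 : ℝ))⌋₊ := by
  classical
  set τ : ℝ := min η 1 / 3 with hτ
  have hτpos : 0 < τ := by rw [hτ]; positivity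
  have hτ1 : τ ≤ 1 := by
    rw [hτ]; linarith [min_le_right η 1]
  have hτη : 3 * τ ≤ η := by rw [hτ]; linarith [min_le_left η 1]
  obtain ⟨S, hScard, hScov⟩ := RandomPlanarGeometry.exists_finset_card_le_cover_closedBall (zero_le_one) τ hτpos hτ1
  -- each point of `T` lies in some ball of the cover (after translating by `x`)
  have hcov : ∀ z ∈ T, ∃ y ∈ S, dist (z - x) y ≤ τ := by
    intro z hz
    have : z - x ∈ closedBall (0 : ℂ) 1 := by
      rw [mem_closedBall, dist_zero_right, ← dist_eq_norm]; exact hT z hz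
    obtain ⟨y, hy, hzy⟩ := mem_iUnion₂.1 (hScov this)
    exact ⟨y, hy, mem_closedBall.1 hzy⟩
  choose! g hgS hgd using hcov
  have hinj : Set.InjOn g ↑T := by
    intro z hz z' hz' hzz
    by_contra hne
    have h1 := hgd z hz
    have h2 := hgd z' hz'
    rw [← hzz] at h2
    have : dist z z' ≤ 2 * τ := by
      have := dist_triangle (z - x) (g z) (z' - x)
      rw [dist_comm (g z)] at this
      have e : dist (z - x) (z' - x) = dist z z' := by simp [dist_eq_norm]
      linarith
    linarith [hsep z hz z' hz' hne]
  have hmaps : Set.MapsTo g ↑T ↑S := fun z hz ↦ hgS z hz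
  have h1 : T.card ≤ S.card := Finset.card_le_card_of_injOn g hmaps hinj
  have h2 : (S.card : ℝ) ≤ 81 * τ ^ (-(2 : ℝ)) := hScard.trans (by norm_num)
  have h3 : S.card ≤ ⌊81 * τ ^ (-(2 : ℝ))⌋₊ := Nat.le_floor h2
  exact h1.trans h3

/-! ### From a traversal to a stretch of steps -/

section TraversalData

variable {Dm : RandomPlanarGeometry.DobrushinDomain} {δ : ℝ} {ω : SiteConfig (Site 2)} {f₀ g₀ : HexVertex}
  {w : hexGraph.Walk f₀ g₀}

/-- **The polygon is within `δ` of the left point of its current step** (`polyIdx` form).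
[cite: Smirnov2001, §2] -/
theorem dist_toCurve_leftPt_le (hδ : 0 < δ) (hw : IsExplorationPath (dobrushinData Dm δ) ω w) (u : I) :
    dist (w.toCurve (fun F ↦ (δ : ℂ) * hexCenter F) u) (hw.leftPt (polyIdx w.length u)) ≤ δ := by
  have hlen : 0 < w.length := by
    rcases Nat.eq_zero_or_pos w.length with h | h
    · exact absurd (SimpleGraph.Walk.eq_of_length_eq_zero h) hw.ne
    · exact h
  have h := toCurve_mem_polyPiece (δ := δ) hlen u
  exact mem_closedBall.1 (hw.polyPiece_subset_closedBall (show (0:ℝ) ≤ (dobrushinData Dm δ).δ from hδ.le)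
    (polyIdx_lt hlen u) h)

/-- **Data of a traversal.** Let the exploration polygon at mesh `δ ≤ ρ` traverse the shell
`D(x; ρ, R)` between the times `s ≤ t`, with `R ≥ 16Cρ`, `C ≥ 16`. Then there are step
indices `i' ≤ m ≤ j'` strictly between `polyIdx s` and `polyIdx t` such that: the stretch over
`[polyIdx s, polyIdx t]` joins the disc `B̄(x, 4ρ)` to the outside of `B(x, R/2)` (in one of
the two directions); the side segment of the middle step `m` lies in the annulus
`𝔸 = B(x, R/2) ∖ B̄(x, 4ρ)`; the left points of the steps `i', …, j'` are at distance within
`δ` of `[Cρ, R/4]` from `x`; and the stretch `i', …, j'` joins `B̄(x, Cρ + δ)` to the outside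
of `B(x, R/4 - δ)`. [cite: AizenmanBurchardDuke1999, Appendix A] -/
theorem tri_traversal_data (hδ : 0 < δ) (hw : IsExplorationPath (dobrushinData Dm δ) ω w)
    {x : ℂ} {ρ R C : ℝ} (hδρ : δ ≤ ρ) (hC : 16 ≤ C) (hR : 16 * C * ρ ≤ R) {s t : I}
    (hst : (⟨w.toCurve fun F ↦ (δ : ℂ) * hexCenter F⟩ : RandomPlanarGeometry.Curve ℂ).IsTraversal x ρ R s t) :
    ∃ m i' j' : ℕ, polyIdx w.length s < m ∧ m < polyIdx w.length t ∧ i' ≤ m ∧ m ≤ j' ∧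
      polyIdx w.length s ≤ i' ∧ j' ≤ polyIdx w.length t ∧
      ((dist (polyPt δ w (polyIdx w.length s)) x ≤ 4 * ρ ∧ R / 2 ≤ dist (polyPt δ w (polyIdx w.length t + 1)) x) ∨
        (R / 2 ≤ dist (polyPt δ w (polyIdx w.length s)) x ∧ dist (polyPt δ w (polyIdx w.length t + 1)) x ≤ 4 * ρ)) ∧
      hw.sideSeg m ⊆ ball x (R / 2) \ closedBall x (4 * ρ) ∧
      (∀ i, i' ≤ i → i ≤ j' → C * ρ - δ ≤ dist (hw.leftPt i) x ∧ dist (hw.leftPt i) x ≤ R / 4 + δ) ∧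
      ((dist (hw.leftPt i') x ≤ C * ρ + δ ∧ R / 4 - δ ≤ dist (hw.leftPt j') x) ∨
        (R / 4 - δ ≤ dist (hw.leftPt i') x ∧ dist (hw.leftPt j') x ≤ C * ρ + δ)) := by
  have hδ' : (0 : ℝ) ≤ (dobrushinData Dm δ).δ := hδ.le
  have hρ : 0 < ρ := hδ.trans_le hδρ
  have hlen : 0 < w.length := by
    rcases Nat.eq_zero_or_pos w.length with h | h
    · exact absurd (SimpleGraph.Walk.eq_of_length_eq_zero h) hw.ne
    · exact h
  set n := w.length with hn
  set γ : I → ℂ := fun u ↦ w.toCurve (fun F ↦ (δ : ℂ) * hexCenter F) u with hγ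
  set f : I → ℝ := fun u ↦ dist (γ u) x with hf
  have hfc : Continuous f := ((w.toCurve fun F ↦ (δ : ℂ) * hexCenter F).continuous).dist continuous_const
  -- the left point of the current step is within `δ` of `γ u`
  have hnear : ∀ u, dist (hw.leftPt (polyIdx n u)) x ≤ f u + δ ∧ f u - δ ≤ dist (hw.leftPt (polyIdx n u)) x := by
    intro u
    have h := dist_toCurve_leftPt_le hδ hw u
    constructor
    · linarith [dist_triangle (hw.leftPt (polyIdx n u)) (γ u) x, dist_comm (γ u) (hw.leftPt (polyIdx n u))]
    · linarith [dist_triangle (γ u) (hw.leftPt (polyIdx n u)) x]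
  -- the polygon vertices of the current step are within `2δ` of `γ u`
  have hpP : ∀ u, dist (polyPt δ w (polyIdx n u)) x ≤ f u + 2 * δ ∧ f u - 2 * δ ≤ dist (polyPt δ w (polyIdx n u + 1)) x ∧
      f u - 2 * δ ≤ dist (polyPt δ w (polyIdx n u)) x ∧ dist (polyPt δ w (polyIdx n u + 1)) x ≤ f u + 2 * δ := by
    intro u
    have h := dist_toCurve_leftPt_le hδ hw u
    obtain ⟨h1, h2⟩ := hw.dist_polyPt_leftPt_le hδ' (polyIdx_lt hlen u)
    change dist (polyPt δ w (polyIdx n u)) (hw.leftPt (polyIdx n u)) ≤ δ at h1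
    change dist (polyPt δ w (polyIdx n u + 1)) (hw.leftPt (polyIdx n u)) ≤ δ at h2
    refine ⟨?_, ?_, ?_, ?_⟩
    · linarith [dist_triangle (polyPt δ w (polyIdx n u)) (hw.leftPt (polyIdx n u)) x,
        dist_triangle (hw.leftPt (polyIdx n u)) (γ u) x, dist_comm (γ u) (hw.leftPt (polyIdx n u))]
    · linarith [dist_triangle (γ u) (hw.leftPt (polyIdx n u)) x,
        dist_triangle (hw.leftPt (polyIdx n u)) (polyPt δ w (polyIdx n u + 1)) x,
        dist_comm (polyPt δ w (polyIdx n u + 1)) (hw.leftPt (polyIdx n u))]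
    · linarith [dist_triangle (γ u) (hw.leftPt (polyIdx n u)) x,
        dist_triangle (hw.leftPt (polyIdx n u)) (polyPt δ w (polyIdx n u)) x,
        dist_comm (polyPt δ w (polyIdx n u)) (hw.leftPt (polyIdx n u))]
    · linarith [dist_triangle (polyPt δ w (polyIdx n u + 1)) (hw.leftPt (polyIdx n u)) x,
        dist_triangle (hw.leftPt (polyIdx n u)) (γ u) x, dist_comm (γ u) (hw.leftPt (polyIdx n u))]
  -- two times with the same index are at distance `≤ 2δ` in `f`
  have hsame : ∀ u v, polyIdx n u = polyIdx n v → |f u - f v| ≤ 2 * δ := by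
    intro u v huv
    have h1 := dist_toCurve_leftPt_le hδ hw u
    have h2 := dist_toCurve_leftPt_le hδ hw v
    change dist (γ u) (hw.leftPt (polyIdx n u)) ≤ δ at h1
    change dist (γ v) (hw.leftPt (polyIdx n v)) ≤ δ at h2
    rw [huv] at h1
    rw [abs_le]
    constructor <;> linarith [dist_triangle (γ u) (hw.leftPt (polyIdx n v)) x,
      dist_triangle (γ v) (hw.leftPt (polyIdx n v)) x,
      dist_triangle (hw.leftPt (polyIdx n v)) (γ u) x, dist_triangle (hw.leftPt (polyIdx n v)) (γ v) x,
      dist_comm (γ u) (hw.leftPt (polyIdx n v)), dist_comm (γ v) (hw.leftPt (polyIdx n v))]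
  obtain ⟨hst0, hends⟩ := hst
  have hends' : (f s ≤ ρ ∧ R ≤ f t) ∨ (R ≤ f s ∧ f t ≤ ρ) := hends
  clear hends
  have hCρ : 16 * ρ ≤ C * ρ := mul_le_mul_of_nonneg_right hC hρ.le
  have hq : C * ρ < R / 4 := by linarith
  have key : ∀ {s₀ t₀ : I}, s ≤ s₀ → s₀ < t₀ → t₀ ≤ t →
      ((f s₀ = C * ρ ∧ f t₀ = R / 4) ∨ (f s₀ = R / 4 ∧ f t₀ = C * ρ)) →
      (∀ u, s₀ ≤ u → u ≤ t₀ → C * ρ ≤ f u ∧ f u ≤ R / 4) →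
      ∃ m i' j' : ℕ, polyIdx n s < m ∧ m < polyIdx n t ∧ i' ≤ m ∧ m ≤ j' ∧ polyIdx n s ≤ i' ∧ j' ≤ polyIdx n t ∧
        hw.sideSeg m ⊆ ball x (R / 2) \ closedBall x (4 * ρ) ∧
        (∀ i, i' ≤ i → i ≤ j' → C * ρ - δ ≤ dist (hw.leftPt i) x ∧ dist (hw.leftPt i) x ≤ R / 4 + δ) ∧
        ((dist (hw.leftPt i') x ≤ C * ρ + δ ∧ R / 4 - δ ≤ dist (hw.leftPt j') x) ∨
          (R / 4 - δ ≤ dist (hw.leftPt i') x ∧ dist (hw.leftPt j') x ≤ C * ρ + δ)) := by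
    intro s₀ t₀ hss₀ hs₀t₀ ht₀t hlev hmid
    -- the middle time
    have hIVT : ∃ u₀ : I, s₀ ≤ u₀ ∧ u₀ ≤ t₀ ∧ f u₀ = (C * ρ + R / 4) / 2 := by
      rcases hlev with ⟨h1, h2⟩ | ⟨h1, h2⟩
      · obtain ⟨u₀, ⟨hu1, hu2⟩, hu3⟩ := intermediate_value_Icc hs₀t₀.le hfc.continuousOn
          (show (C * ρ + R / 4) / 2 ∈ Icc (f s₀) (f t₀) from ⟨by rw [h1]; linarith, by rw [h2]; linarith⟩)
        exact ⟨u₀, hu1, hu2, hu3⟩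
      · obtain ⟨u₀, ⟨hu1, hu2⟩, hu3⟩ := intermediate_value_Icc' hs₀t₀.le hfc.continuousOn
          (show (C * ρ + R / 4) / 2 ∈ Icc (f t₀) (f s₀) from ⟨by rw [h2]; linarith, by rw [h1]; linarith⟩)
        exact ⟨u₀, hu1, hu2, hu3⟩
    obtain ⟨u₀, hsu₀, hu₀t, hfu₀⟩ := hIVT
    refine ⟨polyIdx n u₀, polyIdx n s₀, polyIdx n t₀, ?_, ?_, polyIdx_mono n hsu₀, polyIdx_mono n hu₀t,
      polyIdx_mono n hss₀, polyIdx_mono n ht₀t, ?_, ?_, ?_⟩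
    · refine lt_of_le_of_ne (polyIdx_mono n (hss₀.trans hsu₀)) fun h ↦ ?_
      have := hsame s u₀ h
      rw [abs_le] at this
      rcases hends' with ⟨h1, -⟩ | ⟨h1, -⟩ <;> linarith [this.1, this.2]
    · refine lt_of_le_of_ne (polyIdx_mono n (hu₀t.trans ht₀t)) fun h ↦ ?_
      have := hsame u₀ t h
      rw [abs_le] at this
      rcases hends' with ⟨-, h1⟩ | ⟨-, h1⟩ <;> linarith [this.1, this.2]
    · -- the side segment of the middle step
      intro z hz
      have h1 := hw.sideSeg_subset_closedBall hδ' (polyIdx_lt hlen u₀) hz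
      rw [mem_closedBall] at h1
      change dist z (hw.leftPt (polyIdx n u₀)) ≤ δ at h1
      have h2 := (hnear u₀).1
      have h3 := (hnear u₀).2
      rw [hfu₀] at h2 h3
      constructor
      · rw [mem_ball]
        linarith [dist_triangle z (hw.leftPt (polyIdx n u₀)) x]
      · rw [mem_closedBall, not_le]
        linarith [dist_triangle (hw.leftPt (polyIdx n u₀)) z x, dist_comm z (hw.leftPt (polyIdx n u₀))]
    · intro i hi1 hi2
      obtain ⟨u, hu1, hu2, rfl⟩ := exists_time_of_polyIdx n hs₀t₀.le hi1 hi2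
      obtain ⟨hm1, hm2⟩ := hmid u hu1 hu2
      exact ⟨by linarith [(hnear u).2], by linarith [(hnear u).1]⟩
    · rcases hlev with ⟨h1, h2⟩ | ⟨h1, h2⟩
      · left
        exact ⟨by linarith [(hnear s₀).1], by linarith [(hnear t₀).2]⟩
      · right
        exact ⟨by linarith [(hnear s₀).2], by linarith [(hnear t₀).1]⟩
  rcases hends' with ⟨hs1, ht1⟩ | ⟨hs1, ht1⟩
  · obtain ⟨s₀, t₀, hss₀, hs₀t₀, ht₀t, hfs₀, hft₀, hmid⟩ :=
      exists_tight_crossing hfc hst0 hq (by linarith) (by linarith)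
    obtain ⟨m, i', j', h1, h2, h3, h4, h5, h6, h7, h8, h9⟩ :=
      key hss₀ hs₀t₀ ht₀t (Or.inl ⟨hfs₀, hft₀⟩) hmid
    refine ⟨m, i', j', h1, h2, h3, h4, h5, h6, Or.inl ⟨?_, ?_⟩, h7, h8, h9⟩
    · linarith [(hpP s).1]
    · linarith [(hpP t).2.1]
  · obtain ⟨s₀, t₀, hss₀, hs₀t₀, ht₀t, hfs₀, hft₀, hmid⟩ :=
      exists_tight_crossing' hfc hst0 hq (by linarith) (by linarith)
    obtain ⟨m, i', j', h1, h2, h3, h4, h5, h6, h7, h8, h9⟩ :=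
      key hss₀ hs₀t₀ ht₀t (Or.inr ⟨hfs₀, hft₀⟩) hmid
    refine ⟨m, i', j', h1, h2, h3, h4, h5, h6, Or.inr ⟨?_, ?_⟩, h7, h8, h9⟩
    · linarith [(hpP s).2.2.1]
    · linarith [(hpP t).2.2.2]

end TraversalData

/-! ### The deterministic core: disjoint genuine arms from many traversals -/

section Arms

variable {Dm : RandomPlanarGeometry.DobrushinDomain} {δ : ℝ} {ω : SiteConfig (Site 2)} {f₀ g₀ : HexVertex}
  {w : hexGraph.Walk f₀ g₀}

/-- **Disjoint genuine arms from many traversals** (the deterministic core of Aizenman–Burchard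
1999, Appendix A, for the hexagonal exploration path, with the boundary bookkeeping of
`TriExplorationBoundary.lean`). Let the exploration polygon of `ω` in `dobrushinData D δ`
(`δ ≤ ρ`) traverse `D(x; ρ, R)` at least `k ≥ (2j₀ + N + 2 choose 2) + 3` times, where
`R ≥ 16Cρ`, `C ≥ 16`, `R ≤ 1`, exterior points at distance `< η` are joined in the exterior
within distance `ρ`, and `η`-separated subsets of `B̄(x, 1)` have at most `N` points. Then `ω`, or
its complement `ωᶜ`, contains `j₀` pairwise disjoint confined open arms of
`A(x; Cρ + 2δ, R/4 - 2δ)`: the side components of the `k` middle steps have pairwise distinct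
unordered pairs (`sidePair_ne`), hence are at least `2j₀ + N + 2` in number; at most `N` of them
contain the mesh point of a site of `∂Ω_δ` in the middle shell (tainted components have
`η`-separated exterior representatives, `exists_exterior_repr` and
`mem_connectedComponentIn_of_exterior_path`); the chains of `j₀` untainted ones of the same side
consist of `ω`-open (left), resp. `ω`-closed (right) sites and are the arms.
[cite: AizenmanBurchardDuke1999, Appendix A] -/
theorem tri_arms_of_hasTraversals (hδ : 0 < δ) (hw : IsExplorationPath (dobrushinData Dm δ) ω w)
    {x : ℂ} {ρ R C η : ℝ} (hδρ : δ ≤ ρ) (hC : 16 ≤ C) (hR : 16 * C * ρ ≤ R) (hR1 : R ≤ 1) (hη : 0 < η)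
    (hjoin : ∀ e ∈ (closure Dm.carrier)ᶜ, ∀ e' ∈ (closure Dm.carrier)ᶜ, dist e e' < η →
      JoinedIn ((closure Dm.carrier)ᶜ ∩ ball e ρ) e e')
    {N j₀ k : ℕ}
    (hN : ∀ T : Finset ℂ, (∀ z ∈ T, z ∈ closedBall x 1) → (∀ z ∈ T, ∀ z' ∈ T, z ≠ z' → η ≤ dist z z') →
      T.card ≤ N)
    (hk : (2 * j₀ + N + 2).choose 2 + 3 ≤ k)
    (htr : (⟨w.toCurve fun F ↦ (δ : ℂ) * hexCenter F⟩ : RandomPlanarGeometry.Curve ℂ).HasTraversals k x ρ R) :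
    ω ∈ disjointOccurrencePow (triArm δ x (C * ρ + 2 * δ) (R / 4 - 2 * δ)) j₀ ∨
      ωᶜ ∈ disjointOccurrencePow (triArm δ x (C * ρ + 2 * δ) (R / 4 - 2 * δ)) j₀ := by
  classical
  have hδ' : (0 : ℝ) < (dobrushinData Dm δ).δ := hδ
  have hρ : 0 < ρ := hδ.trans_le hδρ
  have hCρ : 16 * ρ ≤ C * ρ := mul_le_mul_of_nonneg_right hC hρ.le
  have hk3 : 3 ≤ k := le_of_add_le_right hk
  have hlen : 0 < w.length := by
    rcases Nat.eq_zero_or_pos w.length with h | h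
    · exact absurd (SimpleGraph.Walk.eq_of_length_eq_zero h) hw.ne
    · exact h
  set n := w.length with hn
  set 𝔸 : Set ℂ := ball x (R / 2) \ closedBall x (4 * ρ) with h𝔸
  set X : Set ℂ := 𝔸 \ polyTrace δ w with hX
  obtain ⟨sT, tT, htrav, hsep⟩ := htr
  have hdata := fun q : Fin k ↦ tri_traversal_data hδ hw hδρ hC hR (htrav q)
  choose m i' j' hspec using hdata
  have hm1 := fun q ↦ (hspec q).1
  have hm2 := fun q ↦ (hspec q).2.1
  have hi'm := fun q ↦ (hspec q).2.2.1
  have hmj' := fun q ↦ (hspec q).2.2.2.1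
  have hsi' := fun q ↦ (hspec q).2.2.2.2.1
  have hj't := fun q ↦ (hspec q).2.2.2.2.2.1
  have hends := fun q ↦ (hspec q).2.2.2.2.2.2.1
  have hside := fun q ↦ (hspec q).2.2.2.2.2.2.2.1
  have hrad := fun q ↦ (hspec q).2.2.2.2.2.2.2.2.1
  have hcends := fun q ↦ (hspec q).2.2.2.2.2.2.2.2.2
  clear hspec
  have htn : ∀ q, polyIdx n (tT q) < n := fun q ↦ polyIdx_lt hlen (tT q)
  have hmn : ∀ q, m q < n := fun q ↦ (hm2 q).trans (htn q)
  have hj'n : ∀ q, j' q < n := fun q ↦ (hj't q).trans_lt (htn q)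
  -- side components and their pairs
  set cL : Fin k → Set ℂ := fun q ↦ connectedComponentIn X (hw.leftPt (m q)) with hcL
  set cR : Fin k → Set ℂ := fun q ↦ connectedComponentIn X (hw.rightPt (m q)) with hcR
  have horder : ∀ q q' : Fin k, q ≠ q' → m q < polyIdx n (sT q') ∨ polyIdx n (tT q') < m q := by
    intro q q' hqq
    rcases lt_or_gt_of_ne hqq with h | h
    · left; exact (hm2 q).trans_le (polyIdx_mono n (hsep h).le)
    · right; exact (polyIdx_mono n (hsep h).le).trans_lt (hm1 q)
  have hpair : ∀ q q' : Fin k, q ≠ q' → s(cL q, cR q) ≠ s(cL q', cR q') := by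
    intro q q' hqq
    obtain ⟨c, hcq, hcq'⟩ := Fin.exists_ne_and_ne_of_two_lt q q' hk3
    have hle' := (hsi' q').trans ((hi'm q').trans ((hmj' q').trans (hj't q')))
    have hlec := (hsi' c).trans ((hi'm c).trans ((hmj' c).trans (hj't c)))
    exact hw.sidePair_ne hδ' (x := x) (r₁ := 4 * ρ) (r₂ := R / 2) (by positivity) (by linarith)
      (ma := m q) (mb := m q') (ib := polyIdx n (sT q')) (kb := polyIdx n (tT q') - polyIdx n (sT q'))
      (ic := polyIdx n (sT c)) (kc := polyIdx n (tT c) - polyIdx n (sT c)) (hmn q)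
      (by rw [Nat.add_sub_cancel' hle']; exact htn q') (by rw [Nat.add_sub_cancel' hlec]; exact htn c)
      ⟨(hsi' q').trans (hi'm q'), by rw [Nat.add_sub_cancel' hle']; exact (hmj' q').trans (hj't q')⟩
      (by rw [Nat.add_sub_cancel' hle']; exact horder q q' hqq)
      (by rw [Nat.add_sub_cancel' hlec]; exact horder q c (Ne.symm hcq))
      (by rw [Nat.add_sub_cancel' hlec]; exact horder q' c (Ne.symm hcq'))
      (hside q) (hside q')
      (by rw [Nat.add_sub_cancel' hle']; exact hends q') (by rw [Nat.add_sub_cancel' hlec]; exact hends c)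
  -- the finset of side components
  set comp : Fin k × Bool → Set ℂ := fun qb ↦ if qb.2 then cL qb.1 else cR qb.1 with hcomp
  set Cset : Finset (Set ℂ) := Finset.univ.image comp with hCset
  have hcLmem : ∀ q, cL q ∈ Cset := fun q ↦ Finset.mem_image.2 ⟨(q, true), Finset.mem_univ _, by simp [hcomp]⟩
  have hcRmem : ∀ q, cR q ∈ Cset := fun q ↦ Finset.mem_image.2 ⟨(q, false), Finset.mem_univ _, by simp [hcomp]⟩
  have hmemCset : ∀ c ∈ Cset, ∃ q, c = cL q ∨ c = cR q := by
    intro c hc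
    obtain ⟨⟨q, b⟩, -, rfl⟩ := Finset.mem_image.1 hc
    cases b
    · exact ⟨q, Or.inr (by simp [hcomp])⟩
    · exact ⟨q, Or.inl (by simp [hcomp])⟩
  set V := Cset.card with hV
  have hkV : k ≤ (V + 1).choose 2 := by
    have h1 : (Finset.univ.image fun q : Fin k ↦ s(cL q, cR q)).card = k := by
      rw [Finset.card_image_of_injective _ fun q q' h ↦ by_contra fun hne ↦ hpair q q' hne h]
      simp
    have h2 : (Finset.univ.image fun q : Fin k ↦ s(cL q, cR q)) ⊆ Cset.sym2 := by
      intro pr hpr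
      obtain ⟨q, -, rfl⟩ := Finset.mem_image.1 hpr
      rw [Finset.mk_mem_sym2_iff]
      exact ⟨hcLmem q, hcRmem q⟩
    have := Finset.card_le_card h2
    rw [h1, Finset.card_sym2] at this
    exact this
  have hVge : 2 * j₀ + N + 2 ≤ V := by
    by_contra h
    push Not at h
    have h1 : (V + 1).choose 2 ≤ (2 * j₀ + N + 2).choose 2 := Nat.choose_le_choose 2 (by omega)
    omega
  have hcomp_eq : ∀ c ∈ Cset, ∀ z ∈ c, connectedComponentIn X z = c := by
    intro c hc z hz
    obtain ⟨q, rfl | rfl⟩ := hmemCset c hc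
    · exact (connectedComponentIn_eq hz).symm
    · exact (connectedComponentIn_eq hz).symm
  -- tainted components: those containing the mesh point of a boundary site of the middle shell
  set Tset : Finset (Set ℂ) := Cset.filter (fun c ↦ ∃ p : Site 2, triMeshPoint δ p ∈ c ∧
    p ∈ triMeshBoundary Dm.carrier δ ∧ C * ρ - 2 * δ ≤ dist (triMeshPoint δ p) x ∧
    dist (triMeshPoint δ p) x ≤ R / 4 + 2 * δ) with hTset
  -- the window for the off-domain walks
  set W : Set ℂ := ball x (R / 2 - δ) \ closedBall x (4 * ρ + δ) with hW
  have hWA : ∀ z ∈ W, closedBall z δ ⊆ 𝔸 := by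
    intro z hz y hy
    obtain ⟨hz1, hz2⟩ := hz
    rw [mem_ball] at hz1
    rw [mem_closedBall, not_le] at hz2
    rw [mem_closedBall] at hy
    constructor
    · rw [mem_ball]; linarith [dist_triangle y z x]
    · rw [mem_closedBall, not_le]; linarith [dist_triangle z y x, dist_comm y z]
  have hTcard : Tset.card ≤ N := by
    have hex : ∀ c ∈ Tset, ∃ p : Site 2, triMeshPoint δ p ∈ c ∧ p ∈ triMeshBoundary Dm.carrier δ ∧
        C * ρ - 2 * δ ≤ dist (triMeshPoint δ p) x ∧ dist (triMeshPoint δ p) x ≤ R / 4 + 2 * δ := by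
      intro c hc
      exact (Finset.mem_filter.1 hc).2
    choose! pc hpc using hex
    -- exterior representatives
    have hrep : ∀ c ∈ Tset, ∃ (e : ℂ) (v : Site 2), e ∈ (closure Dm.carrier)ᶜ ∧ v ∈ cutVerts Dm.carrier δ e ∧
        dist e (triMeshPoint δ (pc c)) ≤ 2 * δ ∧ (offDomGraph Dm.carrier δ W).Reachable (pc c) v := by
      intro c hc
      obtain ⟨-, hpb, hr1, hr2⟩ := hpc c hc
      refine exists_exterior_repr Dm.toJordanDomain hδ hpb fun z hz ↦ ?_
      rw [mem_closedBall] at hz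
      constructor
      · rw [mem_ball]; linarith [dist_triangle z (triMeshPoint δ (pc c)) x]
      · rw [mem_closedBall, not_le]
        linarith [dist_triangle (triMeshPoint δ (pc c)) z x, dist_comm z (triMeshPoint δ (pc c))]
    choose! ec vc heE hvc hedist hreach using hrep
    -- representatives of distinct tainted components are `η`-separated
    have hsepc : ∀ c ∈ Tset, ∀ c' ∈ Tset, c ≠ c' → η ≤ dist (ec c) (ec c') := by
      intro c hc c' hc' hcc
      by_contra hlt
      rw [not_le] at hlt
      obtain ⟨hpcm, -, hr1, hr2⟩ := hpc c hc
      obtain ⟨hpcm', -, -, -⟩ := hpc c' hc'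
      have hJ := hjoin _ (heE c hc) _ (heE c' hc') hlt
      set π := hJ.somePath with hπ
      have hπmem : ∀ t, π t ∈ (closure Dm.carrier)ᶜ ∩ ball (ec c) ρ := hJ.somePath_mem
      have hπW : ∀ t, closedBall (π t) (4 * δ) ⊆ W := by
        intro t z hz
        have h1 := (hπmem t).2
        rw [mem_ball] at h1
        rw [mem_closedBall] at hz
        have h2 := hedist c hc
        constructor
        · rw [mem_ball]
          linarith [dist_triangle z (π t) x, dist_triangle (π t) (ec c) x,
            dist_triangle (ec c) (triMeshPoint δ (pc c)) x]
        · rw [mem_closedBall, not_le]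
          linarith [dist_triangle (triMeshPoint δ (pc c)) (ec c) x, dist_triangle (ec c) (π t) x,
            dist_triangle (π t) z x, dist_comm z (π t), dist_comm (π t) (ec c),
            dist_comm (ec c) (triMeshPoint δ (pc c))]
      have hpW : triMeshPoint δ (pc c) ∈ W := by
        constructor
        · rw [mem_ball]; linarith
        · rw [mem_closedBall, not_le]; linarith
      have key := hw.mem_connectedComponentIn_of_exterior_path hδ (A := 𝔸) hWA (hvc c hc) (hreach c hc)
        (hvc c' hc') (hreach c' hc') π (fun t ↦ (hπmem t).1) hπW hpW
      -- hence the two components coincide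
      have h1 := hcomp_eq c (Finset.mem_filter.1 hc).1 _ hpcm
      have h2 := hcomp_eq c' (Finset.mem_filter.1 hc').1 _ hpcm'
      have h3 : connectedComponentIn X (triMeshPoint δ (pc c)) = connectedComponentIn X (triMeshPoint δ (pc c')) :=
        connectedComponentIn_eq key
      exact hcc (h1.symm.trans (h3.trans h2))
    have hinj : Set.InjOn ec ↑Tset := by
      intro c hc c' hc' h
      by_contra hne
      have := hsepc c hc c' hc' hne
      rw [h, dist_self] at this
      linarith
    rw [← Finset.card_image_of_injOn hinj]
    refine hN _ (fun z hz ↦ ?_) (fun z hz z' hz' hzz ↦ ?_)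
    · obtain ⟨c, hc, rfl⟩ := Finset.mem_image.1 hz
      obtain ⟨-, -, -, hr2⟩ := hpc c hc
      rw [mem_closedBall]
      linarith [dist_triangle (ec c) (triMeshPoint δ (pc c)) x, hedist c hc]
    · obtain ⟨c, hc, rfl⟩ := Finset.mem_image.1 hz
      obtain ⟨c', hc', rfl⟩ := Finset.mem_image.1 hz'
      exact hsepc c hc c' hc' fun h ↦ hzz (by rw [h])
  -- untainted components, by side
  set U := Cset \ Tset with hU
  have hUcard : 2 * j₀ + 1 ≤ U.card := by
    have hct : U.card + Tset.card = Cset.card :=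
      Finset.card_sdiff_add_card_eq_card (Finset.filter_subset _ Cset : Tset ⊆ Cset)
    omega
  set UL := U.filter (fun c ↦ ∃ q, c = cL q) with hUL
  set UR := U.filter (fun c ↦ ∃ q, c = cR q) with hUR
  have hULR : U ⊆ UL ∪ UR := by
    intro c hc
    obtain ⟨q, h | h⟩ := hmemCset c (Finset.mem_sdiff.1 hc).1
    · exact Finset.mem_union_left _ (Finset.mem_filter.2 ⟨hc, q, h⟩)
    · exact Finset.mem_union_right _ (Finset.mem_filter.2 ⟨hc, q, h⟩)
  have hsides : j₀ ≤ UL.card ∨ j₀ ≤ UR.card := by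
    by_contra h
    push Not at h
    have hle : U.card ≤ UL.card + UR.card := (Finset.card_le_card hULR).trans (Finset.card_union_le _ _)
    omega
  have huntaint : ∀ c ∈ U, ∀ p : Site 2, triMeshPoint δ p ∈ c → p ∈ triMeshBoundary Dm.carrier δ →
      C * ρ - 2 * δ ≤ dist (triMeshPoint δ p) x → dist (triMeshPoint δ p) x ≤ R / 4 + 2 * δ → False := by
    intro c hc p h1 h2 h3 h4
    obtain ⟨hc1, hc2⟩ := Finset.mem_sdiff.1 hc
    exact hc2 (Finset.mem_filter.2 ⟨hc1, p, h1, h2, h3, h4⟩)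
  -- neighbourhoods of the chain points lie in the annulus
  have hballL : ∀ q i, i' q ≤ i → i ≤ j' q → closedBall (hw.leftPt i) (dobrushinData Dm δ).δ ⊆ 𝔸 := by
    intro q i h1 h2 z hz
    obtain ⟨h3, h4⟩ := hrad q i h1 h2
    rw [mem_closedBall] at hz
    change dist z (hw.leftPt i) ≤ δ at hz
    constructor
    · rw [mem_ball]; linarith [dist_triangle z (hw.leftPt i) x]
    · rw [mem_closedBall, not_le]; linarith [dist_triangle (hw.leftPt i) z x, dist_comm z (hw.leftPt i)]
  have hLR : ∀ i, i < n → dist (hw.rightPt i) (hw.leftPt i) ≤ δ := fun i hi ↦ by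
    rw [dist_comm]; exact (hw.dist_leftPt_rightPt hδ'.le hi).le
  have hballR : ∀ q i, i' q ≤ i → i ≤ j' q → closedBall (hw.rightPt i) (dobrushinData Dm δ).δ ⊆ 𝔸 := by
    intro q i h1 h2 z hz
    obtain ⟨h3, h4⟩ := hrad q i h1 h2
    have h5 := hLR i (h2.trans_lt (hj'n q))
    rw [mem_closedBall] at hz
    change dist z (hw.rightPt i) ≤ δ at hz
    constructor
    · rw [mem_ball]; linarith [dist_triangle z (hw.rightPt i) x, dist_triangle (hw.rightPt i) (hw.leftPt i) x]
    · rw [mem_closedBall, not_le]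
      linarith [dist_triangle (hw.leftPt i) (hw.rightPt i) x, dist_triangle (hw.rightPt i) z x,
        dist_comm z (hw.rightPt i), dist_comm (hw.rightPt i) (hw.leftPt i)]
  have hrR : C * ρ + 2 * δ ≤ R / 4 - 2 * δ + 2 * δ := by linarith
  rcases hsides with hL | hRs
  · -- **left chains**: `ω` has `j₀` disjoint open arms
    left
    obtain ⟨fc, hfinj, hfmem⟩ := exists_injective_of_le_card hL
    have hfU : ∀ i, fc i ∈ U := fun i ↦ (Finset.mem_filter.1 (hfmem i)).1
    have hfq : ∀ i, ∃ q, fc i = cL q := fun i ↦ (Finset.mem_filter.1 (hfmem i)).2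
    choose qf hqf using hfq
    -- left points of the stretch lie in the component `fc i`
    have hvmem : ∀ i j, i' (qf i) ≤ j → j ≤ j' (qf i) → hw.leftPt j ∈ fc i := by
      intro i j h1 h2
      rw [hqf i]
      exact hw.leftPt_mem_connectedComponentIn hδ' (hj'n (qf i)) (hballL (qf i)) h1 h2 (hi'm (qf i)) (hmj' (qf i))
    -- hence no left site of the stretch is frozen: all are `ω`-open
    have hopen : ∀ i j, i' (qf i) ≤ j → j ≤ j' (qf i) → hw.lv j ∈ ω := by
      intro i j h1 h2
      have hbc := hw.lv_mem_bcConfig (h2.trans_lt (hj'n (qf i)))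
      rcases hbc with hA | ⟨-, hω⟩
      · exfalso
        obtain ⟨h3, h4⟩ := hrad (qf i) j h1 h2
        exact huntaint _ (hfU i) (hw.lv j) (hvmem i j h1 h2) (triDiscreteArc_subset_triMeshBoundary _ _ _ hA)
          (by change C * ρ - 2 * δ ≤ dist (hw.leftPt j) x; linarith)
          (by change dist (hw.leftPt j) x ≤ R / 4 + 2 * δ; linarith)
      · exact hω
    refine mem_disjointOccurrencePow_triArm_of_chains_cut hδ.le hrR (ω := ω) (j := j₀)
      (fun i ↦ j' (qf i) - i' (qf i)) (fun i p ↦ hw.lv (i' (qf i) + p)) (fun i p hp ↦ ?_) (fun i p hp ↦ ?_)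
      (fun i ↦ ?_) (fun i i₂ hii p p' hp hp' heq ↦ ?_)
    · have h := hw.lv_succ_eq_or_adj (i := i' (qf i) + p) (by have := hj'n (qf i); omega)
      rcases h with h | h
      · exact Or.inl h.symm
      · exact Or.inr h
    · exact hopen i _ (by omega) (by have := hi'm (qf i); have := hmj' (qf i); omega)
    · simp only [add_zero, Nat.add_sub_cancel' ((hi'm (qf i)).trans (hmj' (qf i)))]
      rcases hcends (qf i) with ⟨h1, h2⟩ | ⟨h1, h2⟩
      · left
        exact ⟨by change dist (hw.leftPt (i' (qf i))) x ≤ _; linarith,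
          by change _ ≤ dist (hw.leftPt (j' (qf i))) x; linarith⟩
      · right
        exact ⟨by change _ ≤ dist (hw.leftPt (i' (qf i))) x; linarith,
          by change dist (hw.leftPt (j' (qf i))) x ≤ _; linarith⟩
    · have h1 := hvmem i (i' (qf i) + p) (by omega) (by have := hi'm (qf i); have := hmj' (qf i); omega)
      have h2 := hvmem i₂ (i' (qf i₂) + p') (by omega) (by have := hi'm (qf i₂); have := hmj' (qf i₂); omega)
      have heq' : hw.leftPt (i' (qf i) + p) = hw.leftPt (i' (qf i₂) + p') := by
        change triMeshPoint _ (hw.lv _) = triMeshPoint _ (hw.lv _); rw [heq]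
      rw [heq'] at h1
      have hc1 := hcomp_eq (fc i) (Finset.mem_sdiff.1 (hfU i)).1 _ h1
      have hc2 := hcomp_eq (fc i₂) (Finset.mem_sdiff.1 (hfU i₂)).1 _ h2
      exact hii (hfinj (hc1.symm.trans hc2))
  · -- **right chains**: `ωᶜ` has `j₀` disjoint open arms
    right
    obtain ⟨fc, hfinj, hfmem⟩ := exists_injective_of_le_card hRs
    have hfU : ∀ i, fc i ∈ U := fun i ↦ (Finset.mem_filter.1 (hfmem i)).1
    have hfq : ∀ i, ∃ q, fc i = cR q := fun i ↦ (Finset.mem_filter.1 (hfmem i)).2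
    choose qf hqf using hfq
    have hvmem : ∀ i j, i' (qf i) ≤ j → j ≤ j' (qf i) → hw.rightPt j ∈ fc i := by
      intro i j h1 h2
      rw [hqf i]
      exact hw.rightPt_mem_connectedComponentIn hδ' (hj'n (qf i)) (hballR (qf i)) h1 h2 (hi'm (qf i)) (hmj' (qf i))
    -- no right site of the stretch is frozen: all are `ω`-closed
    have hclosed : ∀ i j, i' (qf i) ≤ j → j ≤ j' (qf i) → hw.rv j ∉ ω := by
      intro i j h1 h2 hω
      have hbc := hw.rv_not_mem_bcConfig (h2.trans_lt (hj'n (qf i)))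
      have hB : hw.rv j ∈ (dobrushinData Dm δ).triArcB := by
        by_contra hB
        exact hbc (Or.inr ⟨hB, hω⟩)
      obtain ⟨h3, h4⟩ := hrad (qf i) j h1 h2
      have h5 := hLR j (h2.trans_lt (hj'n (qf i)))
      refine huntaint _ (hfU i) (hw.rv j) (hvmem i j h1 h2) (triDiscreteArc_subset_triMeshBoundary _ _ _ hB) ?_ ?_
      · change C * ρ - 2 * δ ≤ dist (hw.rightPt j) x
        linarith [dist_triangle (hw.leftPt j) (hw.rightPt j) x, dist_comm (hw.rightPt j) (hw.leftPt j)]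
      · change dist (hw.rightPt j) x ≤ R / 4 + 2 * δ
        linarith [dist_triangle (hw.rightPt j) (hw.leftPt j) x]
    refine mem_disjointOccurrencePow_triArm_of_chains_cut hδ.le hrR (ω := ωᶜ) (j := j₀)
      (fun i ↦ j' (qf i) - i' (qf i)) (fun i p ↦ hw.rv (i' (qf i) + p)) (fun i p hp ↦ ?_) (fun i p hp ↦ ?_)
      (fun i ↦ ?_) (fun i i₂ hii p p' hp hp' heq ↦ ?_)
    · have h := hw.rv_succ_eq_or_adj (i := i' (qf i) + p) (by have := hj'n (qf i); omega)
      rcases h with h | h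
      · exact Or.inl h.symm
      · exact Or.inr h
    · exact hclosed i _ (by omega) (by have := hi'm (qf i); have := hmj' (qf i); omega)
    · simp only [add_zero, Nat.add_sub_cancel' ((hi'm (qf i)).trans (hmj' (qf i)))]
      have h3 := hLR (i' (qf i)) (by have := hj'n (qf i); have := hi'm (qf i); have := hmj' (qf i); omega)
      have h4 := hLR (j' (qf i)) (hj'n (qf i))
      rcases hcends (qf i) with ⟨h1, h2⟩ | ⟨h1, h2⟩
      · left
        constructor
        · change dist (hw.rightPt (i' (qf i))) x ≤ _
          linarith [dist_triangle (hw.rightPt (i' (qf i))) (hw.leftPt (i' (qf i))) x]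
        · change _ ≤ dist (hw.rightPt (j' (qf i))) x
          linarith [dist_triangle (hw.leftPt (j' (qf i))) (hw.rightPt (j' (qf i))) x,
            dist_comm (hw.rightPt (j' (qf i))) (hw.leftPt (j' (qf i)))]
      · right
        constructor
        · change _ ≤ dist (hw.rightPt (i' (qf i))) x
          linarith [dist_triangle (hw.leftPt (i' (qf i))) (hw.rightPt (i' (qf i))) x,
            dist_comm (hw.rightPt (i' (qf i))) (hw.leftPt (i' (qf i)))]
        · change dist (hw.rightPt (j' (qf i))) x ≤ _
          linarith [dist_triangle (hw.rightPt (j' (qf i))) (hw.leftPt (j' (qf i))) x]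
    · have h1 := hvmem i (i' (qf i) + p) (by omega) (by have := hi'm (qf i); have := hmj' (qf i); omega)
      have h2 := hvmem i₂ (i' (qf i₂) + p') (by omega) (by have := hi'm (qf i₂); have := hmj' (qf i₂); omega)
      have heq' : hw.rightPt (i' (qf i) + p) = hw.rightPt (i' (qf i₂) + p') := by
        change triMeshPoint _ (hw.rv _) = triMeshPoint _ (hw.rv _); rw [heq]
      rw [heq'] at h1
      have hc1 := hcomp_eq (fc i) (Finset.mem_sdiff.1 (hfU i)).1 _ h1
      have hc2 := hcomp_eq (fc i₂) (Finset.mem_sdiff.1 (hfU i₂)).1 _ h2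
      exact hii (hfinj (hc1.symm.trans hc2))

end Arms

/-! ### Proof of the H1 estimate and of `isTightLaws_map_triInterface` -/

/-- **Hypothesis H1 of Aizenman–Burchard for the hexagonal exploration path** (Duke Math. J. 99
(1999), eq. (1.3) and Appendix A, site percolation on `𝕋` at `p = 1/2`, in a Jordan Dobrushin
domain; the tree's formulation with a shell-dependent threshold — literally the hypothesis `h1`
of `isTightLaws_map_triInterface_of_traversalBound`). With `α` from
`tri_annulusCrossing_bound_holds` put `C = 1000`, `j₀ = ⌈3/α⌉₊ + 1`, `η(ρ)` the uniform local
connectedness scale of the exterior of `∂D` at distance `ρ`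
(`JordanDomain.exterior_joinedIn_of_dist_lt`), `N(ρ) = ⌊81 (min η(ρ) 1 / 3)⁻²⌋₊` (packing
number, `card_le_of_separated`), threshold `k(x, ρ, R) = ((2j₀ + N(ρ) + 2) choose 2) + 3`,
`λ = 3`, `K = max ((16C)^3) (2 (8(C+3))^{α j₀})`, `δ₀ = 1`. For `R < 16Cρ` the bound is trivial;
otherwise `tri_arms_of_hasTraversals` puts the event inside `S ∪ compl⁻¹(S)` for
`S = triArm □^{j₀}` of the annulus `A(x; Cρ + 2δ, R/4 - 2δ)`, of probability
`≤ 2 ((Cρ + 3δ)/(R/4 - 3δ))^{α j₀} ≤ K (ρ/R)^3` by the iterated BK inequality, the RSW annulus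
bound and the colour-flip symmetry. (The admissibility hypothesis is not even needed: a site open
under the boundary condition but closed in `ω` lies on the discrete arc `A`, a boundary site, by
the definition of `bcConfig`.) [cite: AizenmanBurchardDuke1999, §1.b (1.3) and Appendix A] -/
theorem triExploration_traversalBound (D : RandomPlanarGeometry.DobrushinDomain) :
    ∃ (k : ℂ → ℝ → ℝ → ℕ) (K lam δ₀ : ℝ), 0 ≤ K ∧ 2 < lam ∧ 0 < δ₀ ∧
      ∀ δ ∈ Set.Ioc (0 : ℝ) δ₀, (dobrushinData D δ).IsAdmissible →
        ∀ (x : ℂ) (ρ R : ℝ), δ ≤ ρ → ρ < R → R ≤ 1 →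
          triSitePercolation half {ω | (triExplorationCurve D δ ω).HasTraversals (k x ρ R) x ρ R} ≤
            ENNReal.ofReal (K * (ρ / R) ^ lam) := by
  classical
  obtain ⟨α, hα, hone⟩ := tri_annulusCrossing_bound_holds
  obtain ⟨C, hCdef⟩ : ∃ C : ℝ, C = 1000 := ⟨1000, rfl⟩
  have hC : (16 : ℝ) ≤ C := by rw [hCdef]; norm_num
  set j₀ : ℕ := ⌈3 / α⌉₊ + 1 with hj₀
  have hαj₀ : (3 : ℝ) ≤ α * j₀ := by
    have h1 : 3 / α ≤ (⌈3 / α⌉₊ : ℝ) := Nat.le_ceil _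
    have h2 : (⌈3 / α⌉₊ : ℝ) ≤ (j₀ : ℝ) := by rw [hj₀]; push_cast; linarith
    calc (3 : ℝ) = α * (3 / α) := by field_simp
      _ ≤ α * j₀ := mul_le_mul_of_nonneg_left (h1.trans h2) hα.le
  -- the uniform local connectedness scale of the exterior, at distance `ρ`
  have hjoinex : ∀ ρ : ℝ, 0 < ρ → ∃ η > 0, ∀ e ∈ (closure D.carrier)ᶜ, ∀ e' ∈ (closure D.carrier)ᶜ,
      dist e e' < η → JoinedIn ((closure D.carrier)ᶜ ∩ ball e ρ) e e' :=
    fun ρ hρ ↦ D.toJordanDomain.exterior_joinedIn_of_dist_lt hρ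
  set ηf : ℝ → ℝ := fun ρ ↦ if h : 0 < ρ then (hjoinex ρ h).choose else 1 with hηf
  have hηf_spec : ∀ ρ (h : 0 < ρ), 0 < ηf ρ ∧ ∀ e ∈ (closure D.carrier)ᶜ, ∀ e' ∈ (closure D.carrier)ᶜ,
      dist e e' < ηf ρ → JoinedIn ((closure D.carrier)ᶜ ∩ ball e ρ) e e' := by
    intro ρ h
    simp only [hηf, dif_pos h]
    obtain ⟨h1, h2⟩ := (hjoinex ρ h).choose_spec
    exact ⟨h1, h2⟩
  set Nf : ℝ → ℕ := fun ρ ↦ ⌊81 * (min (ηf ρ) 1 / 3) ^ (-(2 : ℝ))⌋₊ with hNf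
  set kf : ℂ → ℝ → ℝ → ℕ := fun _ ρ _ ↦ (2 * j₀ + Nf ρ + 2).choose 2 + 3 with hkf
  set K : ℝ := max ((16 * C) ^ (3 : ℕ)) (2 * (8 * (C + 3)) ^ (α * j₀)) with hKdef
  have hK16 : (16 * C) ^ (3 : ℕ) ≤ K := le_max_left _ _
  have hK2 : 2 * (8 * (C + 3)) ^ (α * j₀) ≤ K := le_max_right _ _
  refine ⟨kf, K, 3, 1, le_trans (by positivity) hK16, by norm_num, one_pos, ?_⟩
  intro δ hδ _ x ρ R hδρ hρR hR1
  obtain ⟨hδ0, -⟩ := hδ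
  have hρ : 0 < ρ := hδ0.trans_le hδρ
  have hR : 0 < R := hρ.trans hρR
  set P := triSitePercolation half with hP
  have hrpow : (ρ / R) ^ (3 : ℝ) = (ρ / R) ^ (3 : ℕ) := by
    rw [show (3 : ℝ) = ((3 : ℕ) : ℝ) by norm_num, Real.rpow_natCast]
  rw [hrpow]
  by_cases hreg : 16 * C * ρ ≤ R
  swap
  · -- small ratio: the bound is `≥ 1`
    refine (prob_le_one).trans ?_
    rw [← ENNReal.ofReal_one]
    apply ENNReal.ofReal_le_ofReal
    push Not at hreg
    have h1 : 1 ≤ 16 * C * (ρ / R) := by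
      rw [mul_div_assoc', le_div_iff₀ hR]; linarith
    calc (1 : ℝ) ≤ (16 * C * (ρ / R)) ^ (3 : ℕ) := one_le_pow₀ h1
      _ = (16 * C) ^ (3 : ℕ) * (ρ / R) ^ (3 : ℕ) := by ring
      _ ≤ K * (ρ / R) ^ (3 : ℕ) := by gcongr
  · -- the genuine estimate
    obtain ⟨hη, hjoin⟩ := hηf_spec ρ hρ
    set rA := C * ρ + 2 * δ with hrA
    set RA := R / 4 - 2 * δ with hRA
    set A := triArm δ x rA RA with hA
    set S := disjointOccurrencePow A j₀ with hS
    set r' := C * ρ + 3 * δ with hr'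
    set R' := R / 4 - 3 * δ with hR'
    have hCρ : 16 * ρ ≤ C * ρ := mul_le_mul_of_nonneg_right hC hρ.le
    have hr'0 : 0 ≤ r' / R' := div_nonneg (by rw [hr']; positivity) (by rw [hR']; linarith)
    -- the packing bound
    have hN : ∀ T : Finset ℂ, (∀ z ∈ T, z ∈ closedBall x 1) →
        (∀ z ∈ T, ∀ z' ∈ T, z ≠ z' → ηf ρ ≤ dist z z') → T.card ≤ Nf ρ :=
      fun T hT hsep ↦ card_le_of_separated hη T hT hsep
    -- the event is inside `S ∪ compl ⁻¹' S`
    have hsub : {ω | (triExplorationCurve D δ ω).HasTraversals (kf x ρ R) x ρ R} ⊆ S ∪ compl ⁻¹' S := by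
      intro ω hω
      simp only [mem_setOf_eq] at hω
      rcases explorationCurve_eq_const_or (dobrushinData D δ) ω with hconst | ⟨f₀, g₀, w, hw, hcurve⟩
      · -- junk constant curve: no traversal
        exfalso
        have hc : triExplorationCurve D δ ω = RandomPlanarGeometry.Curve.const (0 : ℂ) := by
          rw [triExplorationCurve, hconst]; rfl
        rw [hc] at hω
        exact RandomPlanarGeometry.Curve.not_hasTraversals_const _ (by simp [hkf]) hρR hω
      · have hc : triExplorationCurve D δ ω = ⟨w.toCurve fun F ↦ (δ : ℂ) * hexCenter F⟩ := by
          rw [triExplorationCurve, hcurve]; rfl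
        rw [hc] at hω
        rcases tri_arms_of_hasTraversals hδ0 hw hδρ hC hreg hR1 hη hjoin (N := Nf ρ) (j₀ := j₀) hN le_rfl hω with h | h
        · exact Or.inl h
        · exact Or.inr h
    -- probabilities
    obtain ⟨F, hAF⟩ := exists_finset_determinedBy_triArm hδ0 x rA RA
    have hPS : P S ≤ ENNReal.ofReal ((r' / R') ^ (α * j₀)) := by
      have h1 : P.real S ≤ (P.real A) ^ j₀ := by
        rw [hP, triSitePercolation]
        exact real_disjointOccurrencePow_le_pow half hAF (isUpperSet_triArm δ x rA RA) j₀
      have h2 : P.real A ≤ (r' / R') ^ α := by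
        have := real_triArm_le hone hδ0 x (r := rA) (R := RA) (by rw [hrA, hCdef]; nlinarith) (by rw [hrA, hRA]; linarith)
        have e1 : rA + δ = r' := by rw [hrA, hr']; ring
        have e2 : RA - δ = R' := by rw [hRA, hR']; ring
        rw [e1, e2] at this
        exact this
      have h3 : P.real S ≤ ((r' / R') ^ α) ^ j₀ := h1.trans (pow_le_pow_left₀ measureReal_nonneg h2 j₀)
      rw [← Real.rpow_natCast, ← Real.rpow_mul hr'0] at h3
      calc P S = ENNReal.ofReal (P.real S) := (ENNReal.ofReal_toReal (measure_ne_top _ _)).symm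
        _ ≤ ENNReal.ofReal ((r' / R') ^ (α * j₀)) := ENNReal.ofReal_le_ofReal h3
    have hPdual : P (compl ⁻¹' S) = P S := by
      have h := triSitePercolation_half_real_preimage_compl S
      rw [← hP] at h
      calc P (compl ⁻¹' S) = ENNReal.ofReal (P.real (compl ⁻¹' S)) := (ENNReal.ofReal_toReal (measure_ne_top _ _)).symm
        _ = ENNReal.ofReal (P.real S) := by rw [h]
        _ = P S := ENNReal.ofReal_toReal (measure_ne_top _ _)
    -- the real inequality `2 (r'/R')^{αj₀} ≤ K (ρ/R)^3`
    have hratio : r' / R' ≤ 8 * (C + 3) * (ρ / R) := by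
      have hR'pos : 0 < R' := by rw [hR']; linarith
      rw [div_le_iff₀ hR'pos, hr', hR']
      have : 8 * (C + 3) * (ρ / R) * (R / 4 - 3 * δ) = (C + 3) * ρ * 2 - 8 * (C + 3) * (ρ / R) * 3 * δ := by
        field_simp
        ring
      nlinarith [mul_pos hρ hR, div_nonneg hρ.le hR.le, mul_nonneg (by linarith : (0:ℝ) ≤ C + 3) (div_nonneg hρ.le hR.le)]
    have hreal : 2 * (r' / R') ^ (α * j₀) ≤ K * (ρ / R) ^ (3 : ℕ) := by
      have hexp0 : 0 ≤ α * j₀ := by positivity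
      have h1 : (r' / R') ^ (α * j₀) ≤ (8 * (C + 3) * (ρ / R)) ^ (α * j₀) :=
        Real.rpow_le_rpow hr'0 hratio hexp0
      have hρR : ρ / R ≤ 1 := (div_le_one hR).2 hρR.le
      have hρR0 : 0 ≤ ρ / R := div_nonneg hρ.le hR.le
      have h2 : (8 * (C + 3) * (ρ / R)) ^ (α * j₀) = (8 * (C + 3)) ^ (α * j₀) * (ρ / R) ^ (α * j₀) :=
        Real.mul_rpow (by positivity) hρR0
      have h3 : (ρ / R) ^ (α * j₀) ≤ (ρ / R) ^ (3 : ℕ) := by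
        rw [← Real.rpow_natCast]
        exact Real.rpow_le_rpow_of_exponent_ge (div_pos hρ hR) hρR (by push_cast; exact hαj₀)
      calc 2 * (r' / R') ^ (α * j₀) ≤ 2 * ((8 * (C + 3)) ^ (α * j₀) * (ρ / R) ^ (α * j₀)) := by rw [← h2]; linarith
        _ ≤ 2 * ((8 * (C + 3)) ^ (α * j₀) * (ρ / R) ^ (3 : ℕ)) := by gcongr
        _ = (2 * (8 * (C + 3)) ^ (α * j₀)) * (ρ / R) ^ (3 : ℕ) := by ring
        _ ≤ K * (ρ / R) ^ (3 : ℕ) := by gcongr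
    calc P {ω | (triExplorationCurve D δ ω).HasTraversals (kf x ρ R) x ρ R}
        ≤ P (S ∪ compl ⁻¹' S) := measure_mono hsub
      _ ≤ P S + P (compl ⁻¹' S) := measure_union_le _ _
      _ ≤ ENNReal.ofReal ((r' / R') ^ (α * j₀)) + ENNReal.ofReal ((r' / R') ^ (α * j₀)) :=
          add_le_add hPS (hPdual.le.trans hPS)
      _ = ENNReal.ofReal (2 * (r' / R') ^ (α * j₀)) := by
          rw [← ENNReal.ofReal_add (Real.rpow_nonneg hr'0 _) (Real.rpow_nonneg hr'0 _)]; ring_nf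
      _ ≤ ENNReal.ofReal (K * (ρ / R) ^ (3 : ℕ)) := ENNReal.ofReal_le_ofReal hreal

/-- **crit-perc.S26, triangular case: the interface laws are tight.** Discharge of
`Literature.Probability.Percolation.isTightLaws_map_triInterface` (Aizenman–Burchard 1999,
Thm 1.2, for the hexagonal exploration path of critical site percolation on `δ𝕋` in a Jordan
Dobrushin domain; Camia–Newman 2007, §5): the abstract tightness criterion (AB99 Thms 1.1–1.2),
the lattice short-distance cutoff and the large-mesh case (`InterfaceScalingLimitTriProofs.lean`),
and the H1 estimate `triExploration_traversalBound` above. [cite: AizenmanBurchardDuke1999, Thm 1.2] -/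
theorem isTightLaws_map_triInterface_holds : isTightLaws_map_triInterface :=
  isTightLaws_map_triInterface_of_traversalBound triExploration_traversalBound

end Literature.Probability.Percolation
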